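import Literature.AlgebraicGeometry.Motives.DeRhamComparisonFrolicherFiniteProofs
import Literature.NumberTheory.Transcendental.DolbeaultFiniteOfHodgeProofs
import HarnessLib

/-!
# The Frölicher inequality from the Hodge theorem for `∂̄`

Topic `AlgebraicGeometry/Motives`, statement **hodge.S18** (`DeRhamComparison.lean`): the analytic
core of the Frölicher inequality, the named fact
`Literature.AlgebraicGeometry.Motives.finrank_complexDeRham_le_sum_hodgeNumber`
(`dim_ℂ H^k_dR(M; ℂ) ≤ ∑_{p+q=k} h^{p,q}(M)` for a compact Hausdorff complex manifold; Voisin (2002),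
§8.3.3, proof of Thm. 8.28, pp. 204–205), was reduced in
`DeRhamComparisonFrolicherFiniteProofs` to Cartan–Serre finiteness alone
(`finrank_complexDeRham_le_sum_hodgeNumber_of_finite : finite_dolbeaultCohomology → …`), and
Cartan–Serre was reduced in `Literature/NumberTheory/Transcendental/DolbeaultFiniteOfHodgeProofs`
to the Hodge theorem for `Δ_∂̄` (Voisin's own route, Cor. 5.25 ⇐ Thms. 5.22/5.24).  This file
records the composite:

* `finrank_complexDeRham_le_sum_hodgeNumber_of_hodgeTheory`: the two Hodge(`∂̄`) named facts of
  `KaehlerHodge.lean` (`existsUnique_isDolbeaultHarmonic_mk_eq`, `finite_dolbeaultHarmonicForms`,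
  for all metrics and orientations on `M`) imply `finrank_complexDeRham_le_sum_hodgeNumber E M`;
* `bettiNumber_le_sum_hodgeNumber_of_hodgeTheory_of_exists_complexDeRhamIsoFamily`: adding de
  Rham's theorem (`exists_complexDeRhamIsoFamily E`) gives the Frölicher inequality
  `b_k ≤ ∑ h^{p,q}` (`bettiNumber_le_sum_hodgeNumber E M`).

So the trust base of hodge.S18's inequality is now {Hodge theorem for `Δ_∂̄`, de Rham's theorem}:
every other input (type calculus, `d = ∂ + ∂̄`, the Frölicher spectral-sequence inequality,
existence of Hermitian metrics, the complex orientation) is proved in the tree.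

## References

* C. Voisin, *Hodge Theory and Complex Algebraic Geometry I* (2002), §8.3.3, proof of Thm. 8.28
  and Rem. 8.29, pp. 204–205; §5.3.1, Cor. 5.25, p. 129 (`VoisinHodgeI2002`).
* A. Frölicher, Proc. Nat. Acad. Sci. USA 41 (1955), 641–644, §2 (`FrolicherPNAS1955`).
-/

noncomputable section

open scoped Manifold ContDiff
open Module Finset Bundle
open Literature.Geometry.Kaehler Literature.NumberTheory.Transcendental

namespace Literature.AlgebraicGeometry.Motives

variable (E : Type) [NormedAddCommGroup E] [NormedSpace ℂ E]
  (M : Type) [TopologicalSpace M] [ChartedSpace E M] [IsManifold 𝓘(ℝ, E) ∞ M]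

/-- **The analytic core of the Frölicher inequality from the Hodge theorem for `∂̄`**:
if for every `C^∞` Riemannian metric `g` and orientation family `o` on the compact Hausdorff
complex manifold `M` every Dolbeault class has a `Δ_∂̄`-harmonic representative (`hH`,
`existsUnique_isDolbeaultHarmonic_mk_eq g o`) and the harmonic spaces `ℋ^{p,q}` are
finite-dimensional (`hF`, `finite_dolbeaultHarmonicForms g o`) — Voisin (2002), Thms. 5.22, 5.24 —
then `dim_ℂ H^k_dR(M; ℂ) ≤ ∑_{p+q=k} h^{p,q}(M)` (`finrank_complexDeRham_le_sum_hodgeNumber E M`):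
Cartan–Serre by `finite_dolbeaultCohomology_of_hodgeTheory` (Cor. 5.25), then the Frölicher
spectral-sequence inequality `finrank_complexDeRham_le_sum_hodgeNumber_of_finite` (§8.3.3,
pp. 204–205). [cite: VoisinHodgeI2002, §8.3.3, proof of Thm. 8.28; §5.3.1 Cor. 5.25] -/
theorem finrank_complexDeRham_le_sum_hodgeNumber_of_hodgeTheory
    (hH : ∀ [FiniteDimensional ℂ E] {n : ℕ} [Fact (finrank ℝ E = n)]
      (g : ContMDiffRiemannianMetric 𝓘(ℝ, E) ∞ E (fun x : M ↦ TangentSpace 𝓘(ℝ, E) x))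
      (o : (x : M) → Orientation ℝ (TangentSpace 𝓘(ℝ, E) x) (Fin n)) {m : ℕ},
      existsUnique_isDolbeaultHarmonic_mk_eq (m := m) g o)
    (hF : ∀ [FiniteDimensional ℂ E] {n : ℕ} [Fact (finrank ℝ E = n)]
      (g : ContMDiffRiemannianMetric 𝓘(ℝ, E) ∞ E (fun x : M ↦ TangentSpace 𝓘(ℝ, E) x))
      (o : (x : M) → Orientation ℝ (TangentSpace 𝓘(ℝ, E) x) (Fin n)) {k m : ℕ},
      finite_dolbeaultHarmonicForms (k := k) (m := m) g o) :
    finrank_complexDeRham_le_sum_hodgeNumber E M := by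
  -- tactic mode on purpose: a term-mode proof would implicit-lambda the fact's own instance
  -- binders into the statement next to the section instances (overlapping instances)
  intro _ _ _ _ _ k
  exact finrank_complexDeRham_le_sum_hodgeNumber_of_finite E M
    (finite_dolbeaultCohomology_of_hodgeTheory hH hF) k

/-- **The Frölicher inequality `b_k(M; ℂ) ≤ ∑_{p+q=k} h^{p,q}(M)`** (hodge.S18,
`bettiNumber_le_sum_hodgeNumber E M`) for a compact complex manifold, from the Hodge theorem for
`∂̄` (`hH`, `hF` as in `finrank_complexDeRham_le_sum_hodgeNumber_of_hodgeTheory`) and de Rham's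
theorem `exists_complexDeRhamIsoFamily E`. Voisin (2002), §8.3.3, Rem. 8.29; Frölicher (1955), §2.
[cite: VoisinHodgeI2002, §8.3.3, proof of Thm. 8.28 and Rem. 8.29] -/
theorem bettiNumber_le_sum_hodgeNumber_of_hodgeTheory_of_exists_complexDeRhamIsoFamily
    (hH : ∀ [FiniteDimensional ℂ E] {n : ℕ} [Fact (finrank ℝ E = n)]
      (g : ContMDiffRiemannianMetric 𝓘(ℝ, E) ∞ E (fun x : M ↦ TangentSpace 𝓘(ℝ, E) x))
      (o : (x : M) → Orientation ℝ (TangentSpace 𝓘(ℝ, E) x) (Fin n)) {m : ℕ},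
      existsUnique_isDolbeaultHarmonic_mk_eq (m := m) g o)
    (hF : ∀ [FiniteDimensional ℂ E] {n : ℕ} [Fact (finrank ℝ E = n)]
      (g : ContMDiffRiemannianMetric 𝓘(ℝ, E) ∞ E (fun x : M ↦ TangentSpace 𝓘(ℝ, E) x))
      (o : (x : M) → Orientation ℝ (TangentSpace 𝓘(ℝ, E) x) (Fin n)) {k m : ℕ},
      finite_dolbeaultHarmonicForms (k := k) (m := m) g o)
    [FiniteDimensional ℂ E] (hdR : exists_complexDeRhamIsoFamily E) :
    bettiNumber_le_sum_hodgeNumber E M := by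
  intro _ _ _ _ _ k
  exact bettiNumber_le_sum_hodgeNumber_of_finite_of_exists_complexDeRhamIsoFamily E M
    (finite_dolbeaultCohomology_of_hodgeTheory hH hF) hdR k

end Literature.AlgebraicGeometry.Motives
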